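import Literature.NumberTheory.EllipticCurves.Sprung2024.ChromaticKerGLocalBoundProofs
import Literature.NumberTheory.EllipticCurves.SelmerCorankControlRatLevelZeroProofs
import HarnessLib

/-!
# `#(A'/Sel_0) = ∏_{w ∈ S} #𝒦_{w,0}[p^∞]` when Greenberg's evaluation map is ONTO — the equality form of
# the K3 lane's divisibility `…_dvd_prod_natCard_localTowerKerPrimary` (Greenberg, LNM 1716 p. 104:
# «`ker(g) = ker(r) ∩ 𝒢^Σ(F)`»; «by Cassels' theorem, `ker(g) = ker(r)`», `|ker(r)| = ∏_v |ker(r_v)|`)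

Seat `bsd-2adic-ss-1` GEN 12, crux `SupersingularRankZeroAtTwo` (item stmt-BirchSwinnertonDyer-19097, route
`ByReductionTypeAtTwo`, rung K4), line `flat_uniform_two` v1, stub (2) `stub_allFlatData`, conjunct
COUNT♭@2 — part 8a of the series (part 8b `…FlatCasselsCount`: the surjectivity from Cassels' theorem for
`A♭_0`, and `#ker g♭ = p^{ord_p ∏ c_ℓ}`). For ANY number field `K`, prime `p`, `ℤ_p`-extension `κ`, any
`A' ⊆ A_0 = h_0⁻¹(Sel_∞)` classically Kummer above `p`, and `S` a finite set of finite places off which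
(and off `p`) `E` is good: the K3 lane's evaluation map `Φ : A' → ∏_{w∈S} 𝒦_{w,0}[p^∞]`, `y ↦ (loc_w y)_w`
(values in the `p`-power torsion of the local tower kernels), has kernel EXACTLY `Sel_0 ∩ A'` (`⊆`:
good places `𝒦 = 0`, archimedean places split, above `p` the hypothesis — the K3 argument; `⊇`: a Selmer
class has trivial local classes), so if every family `(k_w)_w` is a value of `Φ` on `A'` then
**`#(A'/Sel_0) = ∏_{w ∈ S} #𝒦_{w,0}[p^∞]`** (`natCard_quotient_selmerLayer_zero_eq_prod_of_forall_exists`).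
The surjectivity is what Cassels' theorem supplies (part 8b). HONEST FRAMING: a kernel theorem about the
tree's objects; nothing about any curve is asserted; no census cell moves; BSD is not proved by any of this.
The construction of `Φ` and the inclusion `ker Φ ⊆ Sel_0` are adapted from the K3 lane's
`WeierstrassCurve.natCard_quotient_selmerLayer_zero_dvd_prod_natCard_localTowerKerPrimary`
(`Sprung2024/ChromaticKerGLocalBoundProofs.lean`, credit `bsd-ssimc-k3c5-kdot-split`).

References: [GreenbergLNM1716] §3 Lemma 3.3 (pp. 86–88); §4 p. 104, Lemma 4.7 (p. 107);
[Sprung2024] §5.2 proof of Lemma 5.5 (p. 40).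
-/

set_option autoImplicit false
-- the Theorems namespace of this sub repeats the summit name by design (D-0017 nested layout)
set_option linter.dupNamespace false

noncomputable section

open scoped Classical NumberField

open NumberField IsDedekindDomain

universe u

namespace Summit.BirchSwinnertonDyer.BirchSwinnertonDyer.Theorems.SSFlatEC

open Literature.NumberTheory.EllipticCurves Literature.NumberTheory.GaloisRepresentations
  WeierstrassCurve ZpExtension Literature.NumberTheory.EllipticCurves.Kobayashi2003
  Literature.NumberTheory.EllipticCurves.Sprung2017 Literature.NumberTheory.EllipticCurves.Sprung2012
  Literature.NumberTheory.EllipticCurves.Sprung2024 Literature.NumberTheory.EllipticCurves.IwasawaDual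


/-! ## §1 Generic: `Φ` surjective ⇒ `#(A'/Sel_0) = ∏_{w ∈ S} #𝒦_{w,0}[p^∞]` -/

section Generic

variable {K : Type u} [Field K] [NumberField K] (W : WeierstrassCurve K) [W.IsElliptic] {p : ℕ}
  [Fact p.Prime] (κ : ZpExtension K p)

/-- **`#(A'/Sel_0) = ∏_{w ∈ S} #𝒦_{w,0}[p^∞]` when the evaluation map is onto** (Greenberg, LNM 1716
p. 104: «`ker(g) = ker(r) ∩ 𝒢^Σ(F)`» and, «by Cassels' theorem, `ker(g) = ker(r)`», `|ker(r)| = ∏|ker(r_v)|`).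
For `A' ⊆ A_0 = h_0⁻¹(Sel_∞)` classically Kummer above `p` and `S` a finite set of finite places off which
(and off `p`) `E` is good: the evaluation `Φ : A' → ∏_{w∈S} 𝒦_{w,0}[p^∞]`, `y ↦ (loc_w y)_w`, has kernel
EXACTLY `Sel_0 ∩ A'` (`⊆`: the K3 lane's argument — good places `𝒦 = 0`, archimedean places split, above `p`
the hypothesis; `⊇`: a Selmer class has trivial local classes); if moreover every family `(k_w)_w` is a
value of `Φ` then `A'/Sel_0 ≅ ∏ 𝒦_{w,0}[p^∞]`. [cite: GreenbergLNM1716, §4 p. 104 and Lemma 4.7 (p. 107);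
§3 Lemma 3.3 (pp. 86–88)] [cite: Sprung2024, §5.2 proof of Lemma 5.5 (p. 40)] -/
theorem natCard_quotient_selmerLayer_zero_eq_prod_of_forall_exists
    (A' : AddSubgroup (W.subgroupH1 p (κ.layerSubgroup 0)))
    (hA' : A' ≤ W.selmerInftyPreimage κ 0)
    (hp : ∀ v : HeightOneSpectrum (𝓞 K), (p : 𝓞 K) ∈ v.asIdeal → ∀ y ∈ A',
      W.localResOver p (κ.layerSubgroup 0) (v.adicCompletion K) y = 0)
    (S : Finset (HeightOneSpectrum (𝓞 K)))
    (hS : ∀ v : HeightOneSpectrum (𝓞 K), v ∉ S → (p : 𝓞 K) ∉ v.asIdeal → W.HasGoodReductionAt v)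
    (hsurj : ∀ k : (Π v : ↥S, ↥(W.localTowerKerPrimary κ (v.1.adicCompletion K) 0)), ∃ y ∈ A',
      ∀ v : ↥S, W.localResOver p (κ.layerSubgroup 0) (v.1.adicCompletion K) y = (k v : _)) :
    Nat.card (↥A' ⧸ (W.selmerLayer κ 0).addSubgroupOf A') =
      ∏ v ∈ S, Nat.card (W.localTowerKerPrimary κ (v.adicCompletion K) 0) := by
  -- at layer `0` every `conj_σ` is the identity (`Gal(K̄/K_0) = Γ_K`)
  have hconj : ∀ (σ : Field.absoluteGaloisGroup K) (y : W.subgroupH1 p (κ.layerSubgroup 0)),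
      W.conjH1 p (κ.layerSubgroup 0) σ y = y := fun σ y ↦ by
    rw [W.conjH1_of_mem_holds p (κ.layerSubgroup 0)
      (show σ ∈ κ.layerSubgroup 0 by rw [ZpExtension.layerSubgroup_zero]; trivial),
      AddMonoidHom.id_apply]
  -- for `y ∈ A' ⊆ A_0`, `loc_v y ∈ 𝒦_{v,0}[p^∞]` at every finite place
  have hprimary : ∀ (y : ↥A') (v : HeightOneSpectrum (𝓞 K)),
      W.localResOver p (κ.layerSubgroup 0) (v.adicCompletion K) (y : W.subgroupH1 p _) ∈
        W.localTowerKerPrimary κ (v.adicCompletion K) 0 := by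
    intro y v
    obtain ⟨k, hk⟩ := W.exists_pow_smul_subgroupH1_layer_eq_zero κ 0 (y : W.subgroupH1 p _)
    have hmem := W.localResOver_conjH1_mem_localTowerKer_of_mem κ (hA' y.2) v 1
    rw [hconj] at hmem
    exact ⟨hmem, k, by rw [← map_nsmul, hk, map_zero]⟩
  -- the evaluation map `Φ y = (loc_v y)_{v ∈ S}`, corestricted to the local tower kernels
  let Φ : ↥A' →+ (Π v : ↥S, ↥(W.localTowerKerPrimary κ (v.1.adicCompletion K) 0)) :=
    AddMonoidHom.pi fun v ↦
      ((W.localResOver p (κ.layerSubgroup 0) (v.1.adicCompletion K)).comp A'.subtype).codRestrict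
        (W.localTowerKerPrimary κ (v.1.adicCompletion K) 0) fun y ↦ hprimary y v.1
  have hΦ : ∀ (y : ↥A') (v : ↥S), ((Φ y v : ↥(W.localTowerKerPrimary κ (v.1.adicCompletion K) 0)) :
      discreteH1 (localSubgroup (κ.layerSubgroup 0) (v.1.adicCompletion K))
        (localPoints W (v.1.adicCompletion K))) =
      W.localResOver p (κ.layerSubgroup 0) (v.1.adicCompletion K) (y : W.subgroupH1 p _) :=
    fun y v ↦ rfl
  -- `ker Φ = Sel_0 ∩ A'`
  have hker : Φ.ker = (W.selmerLayer κ 0).addSubgroupOf A' := by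
    apply le_antisymm
    · intro y hy
      rw [AddSubgroup.mem_addSubgroupOf]
      change (y : W.subgroupH1 p (κ.layerSubgroup 0)) ∈ W.selmerGroupOver p (κ.layerSubgroup 0)
      rw [mem_selmerGroupOver_iff]
      refine ⟨fun v σ ↦ ?_, fun w σ ↦ ?_⟩
      · rw [hconj, mem_localKerOver_iff]
        by_cases hpv : (p : 𝓞 K) ∈ v.asIdeal
        · exact hp v hpv _ y.2
        · by_cases hvS : v ∈ S
          · have h0 : Φ y ⟨v, hvS⟩ = 0 := by
              have := congrFun (congrArg (fun f ↦ (f : Π v : ↥S, _)) ((AddMonoidHom.mem_ker).mp hy))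
                ⟨v, hvS⟩
              exact this
            have := congrArg (fun z : ↥(W.localTowerKerPrimary κ (v.adicCompletion K) 0) ↦
              (z : discreteH1 (localSubgroup (κ.layerSubgroup 0) (v.adicCompletion K))
                (localPoints W (v.adicCompletion K)))) h0
            rw [hΦ y ⟨v, hvS⟩] at this
            exact this
          · have hgood := hS v hvS hpv
            have hmem := hprimary y v
            rw [W.localTowerKerPrimary_zero_eq_bot_of_hasGoodReductionAt κ v hpv hgood,
              AddSubgroup.mem_bot] at hmem
            exact hmem
      · rw [hconj, mem_localKerOver_iff]
        have hmem := W.localResOver_conjH1_mem_localTowerKer_of_mem_infinitePlace κ (hA' y.2) w 1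
        rw [hconj, W.localTowerKer_eq_bot_of_forall_mem κ w.Completion 0
          (κ.resGal_infinitePlace_mem_kerSubgroup w), AddSubgroup.mem_bot] at hmem
        exact hmem
    · intro y hy
      rw [AddSubgroup.mem_addSubgroupOf] at hy
      have hy' := ((W.mem_selmerGroupOver_iff p (κ.layerSubgroup 0) _).mp hy).1
      rw [AddMonoidHom.mem_ker]
      funext v
      apply Subtype.ext
      rw [hΦ]
      have h := hy' v.1 1
      rw [hconj, mem_localKerOver_iff] at h
      exact h
  -- `Φ` is surjective
  have hsurjΦ : Function.Surjective Φ := fun k ↦ by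
    obtain ⟨y, hyA, hy⟩ := hsurj k
    refine ⟨⟨y, hyA⟩, funext fun v ↦ Subtype.ext ?_⟩
    rw [hΦ]
    exact hy v
  -- `A'/Sel_0 = A'/ker Φ ≅ ∏ 𝒦`
  rw [← hker, Nat.card_congr (QuotientAddGroup.quotientKerEquivOfSurjective Φ hsurjΦ).toEquiv,
    Nat.card_pi, ← Finset.prod_coe_sort S]

end Generic

end Summit.BirchSwinnertonDyer.BirchSwinnertonDyer.Theorems.SSFlatEC

end
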